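import Mathlib
import Literature.AlgebraicGeometry.Resolution.ChartTwoPolygonLaws
import Literature.AlgebraicGeometry.Resolution.SolvableVertexTransport
import Literature.AlgebraicGeometry.Resolution.FacePreparation
import HarnessLib

/-!
# The vertex at the point `(0:1)`: `β″ = α + β − 1` and `v″`-preparedness

Topic: `Literature/AlgebraicGeometry/Resolution`. At the origin `x″` of the `u₂`-chart of the
blowing up of `x` (the point "`(0:1)`" of Cossart–Jannsen–Saito, LNM 2270, Lemma 12.2; the point
`x′₁` of Cossart–Piltant 2008, Lemma 4.5 (2)), the affine map `T(x₁, x₂) = (x₁, x₁ + x₂ − 1)`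
carries the polygon of `(y, u₁, u₂)` into that of `(y″, u₁″, u₂)` and the vertex `v` to the
vertex `v″`. PROVED (no facts):

* `IsInForm.comp_σ₁₂`, `inForm_comp_σ₁₂`, `isSolvableAt_comp_σ₁₂_iff` — initial forms and
  solvability under the swap `u₁ ↔ u₂`;
* `forall_pts_colon_two_of_forall_pts` — transport of half-planes through the `u₂`-chart;
* `betaS_colon_two_add_eq` — **`βs″ + L = αs + βs`** (CJS Lemma 12.2 (3) with equality);
* `vPrepared_colon_two` — **if `(y, u)` is `v`-prepared then `(y″, u″)` is `v″`-prepared**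
  (residue map surjective), by the swap, `isSolvableAt_of_chart` and the independence of the
  supporting line.

## Sources

* V. Cossart, U. Jannsen, S. Saito, LNM 2270 (2020), Lemma 12.2 (3)–(5), Lemma 8.3.
  [CossartJannsenSaito2020]
* V. Cossart, O. Piltant, J. Algebra 320 (2008), Lemma 4.5 (2), the point `x′₁`. [CossartPiltant2008]
-/

noncomputable section

open IsLocalRing MvPolynomial

namespace Literature.AlgebraicGeometry.Resolution

universe u

/-! ## Initial forms and solvability under the swap -/

section Swap

variable {R : Type u} [CommRing R]

/-- An initial form witness for `(c ∘ σ, w ∘ σ)` gives one for `(c, w)` after renaming. [folklore] -/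
theorem IsInForm.of_comp_σ₁₂ [IsLocalRing R] {c : Fin 3 → R} {w : Fin 3 → ℕ} {n : ℕ} {f : R}
    {P : MvPolynomial (Fin 3) (ResidueField R)} (h : IsInForm (c ∘ σ₁₂) (w ∘ σ₁₂) n f P) :
    IsInForm c w n f (rename σ₁₂ P) := by
  obtain ⟨F, hF, hFP, hrem⟩ := h
  refine ⟨rename σ₁₂ F, isWeightedHomogeneous_rename_σ₁₂ hF, by rw [map_rename, hFP], ?_⟩
  rw [eval_rename_σ₁₂, ← weightedIdealW_comp_σ₁₂ c w]
  exact hrem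

/-- An initial form witness for `(c, w)` gives one for `(c ∘ σ, w ∘ σ)` after renaming. [folklore] -/
theorem IsInForm.comp_σ₁₂ [IsLocalRing R] {c : Fin 3 → R} {w : Fin 3 → ℕ} {n : ℕ} {f : R}
    {P : MvPolynomial (Fin 3) (ResidueField R)} (h : IsInForm c w n f P) :
    IsInForm (c ∘ σ₁₂) (w ∘ σ₁₂) n f (rename σ₁₂ P) := by
  have h' : IsInForm ((c ∘ σ₁₂) ∘ σ₁₂) ((w ∘ σ₁₂) ∘ σ₁₂) n f P := by
    rw [comp_σ₁₂_comp_σ₁₂, comp_σ₁₂_comp_σ₁₂]; exact h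
  exact h'.of_comp_σ₁₂

variable [IsRegularLocalRing R] (c : Fin 3 → R)
  (hgen : Ideal.span {c 0, c 1, c 2} = maximalIdeal R) (hdim : ringKrullDim R = 3)

include hgen hdim in
/-- **`in` under the swap**: `in_{(c∘σ, w∘σ)}(f) = rename σ (in_{(c,w)}(f))` (positive weights,
`f ∈ F_n`). [folklore] -/
theorem inForm_comp_σ₁₂ {w : Fin 3 → ℕ} (hw : ∀ i, 0 < w i) {n : ℕ} {f : R}
    (hf : f ∈ weightedIdealW c w n) :
    inForm (c ∘ σ₁₂) (w ∘ σ₁₂) n f = rename σ₁₂ (inForm c w n f) := by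
  have h := (isInForm_inForm c hgen hdim hw hf).comp_σ₁₂
  have hgen' : Ideal.span {(c ∘ σ₁₂) 0, (c ∘ σ₁₂) 1, (c ∘ σ₁₂) 2} = maximalIdeal R := by
    rw [span_triple_comp_σ₁₂]; exact hgen
  exact (h.eq_inForm (c ∘ σ₁₂) hgen' hdim ((forall_pos_comp_σ₁₂_iff w).mpr hw)).symm

/-- Renaming the solvable shape. [folklore] -/
theorem rename_σ₁₂_solvableShape (a lam : ResidueField R) (v : Fin 3 →₀ ℕ) (μ : ℕ) :
    rename σ₁₂ (C a * (X 0 + C lam * monomial v 1) ^ μ : MvPolynomial (Fin 3) (ResidueField R)) =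
      C a * (X 0 + C lam * monomial (eswap v) 1) ^ μ := by
  simp only [map_mul, map_pow, map_add, rename_C, rename_X, σ₁₂_zero, rename_monomial,
    eswap_eq_mapDomain]

include hgen hdim in
/-- **Solvability under the swap**: `(c ∘ σ)` is solvable at `eswap v` along `w ∘ σ` iff `c` is
solvable at `v` along `w`. [folklore] -/
theorem isSolvableAt_comp_σ₁₂_iff (J : Ideal R) {w : Fin 3 → ℕ} (hw : ∀ i, 0 < w i) (n μ : ℕ)
    (v : Fin 3 →₀ ℕ) (lam : ResidueField R) :
    IsSolvableAt (c ∘ σ₁₂) J (w ∘ σ₁₂) n μ (eswap v) lam ↔ IsSolvableAt c J w n μ v lam := by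
  unfold IsSolvableAt
  rw [eswap_apply_zero, weight_comp_σ₁₂, eswap_eswap, Function.comp_apply, σ₁₂_zero,
    weightedIdealW_comp_σ₁₂]
  refine and_congr_right fun _ => and_congr_right fun _ => ?_
  refine forall_congr' fun f => forall_congr' fun _ => forall_congr' fun hfn => ?_
  rw [inForm_comp_σ₁₂ c hgen hdim hw hfn]
  constructor
  · rintro ⟨a, ha⟩
    refine ⟨a, rename_injective _ σ₁₂.injective ?_⟩
    rw [ha, rename_σ₁₂_solvableShape]
  · rintro ⟨a, ha⟩
    exact ⟨a, by rw [ha, rename_σ₁₂_solvableShape]⟩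

end Swap

/-! ## The `u₂`-chart -/

section ChartTwo

variable {R R' : Type u} [CommRing R] [CommRing R'] (φ : R →+* R') {c : Fin 3 → R}
  {c' : Fin 3 → R'} (h₂ : c' 2 = φ (c 2)) (h₀ : φ (c 0) = φ (c 2) * c' 0)
  (h₁ : φ (c 1) = φ (c 2) * c' 1) {J : Ideal R} {μ : ℕ}
  [IsRegularLocalRing R] [IsRegularLocalRing R']
  (hgen : Ideal.span {c 0, c 1, c 2} = maximalIdeal R) (hdim : ringKrullDim R = 3)
  (hgen' : Ideal.span {c' 0, c' 1, c' 2} = maximalIdeal R') (hdim' : ringKrullDim R' = 3)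

local notation "J''" => Submodule.colon (Ideal.map φ J) ({φ (c 2) ^ μ} : Set R')

include h₂ h₀ h₁ hgen hdim hgen' hdim' in
/-- **Transport of half-planes through the `u₂`-chart**: if every point of `pts c J μ` satisfies
`(p₁ + p₂) x₁ + p₂ x₂ ≥ w₀″ + L p₂` (i.e. `p₁ x₁ + p₂ (x₁ + x₂ − L) ≥ w₀″`), then every point of
`pts c′ J″ μ` satisfies `p₁ x₁ + p₂ x₂ ≥ w₀″`. [cite: CossartJannsenSaito2020, Lemma 12.2 (3)] -/
theorem forall_pts_colon_two_of_forall_pts {w₀' p₁ p₂ : ℕ} (hw₀' : 0 < w₀') (hp₁ : 0 < p₁)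
    (hp₂ : 0 < p₂)
    (hS : ∀ e ∈ pts c J μ, w₀' + μ.factorial * p₂ ≤ (p₁ + p₂) * spt₁ μ e + p₂ * spt₂ μ e) :
    ∀ e' ∈ pts c' J'' μ, w₀' ≤ p₁ * spt₁ μ e' + p₂ * spt₂ μ e' := by
  have hS' : ∀ e ∈ pts (c ∘ σ₁₂) J μ,
      w₀' + μ.factorial * p₂ ≤ p₂ * spt₁ μ e + (p₂ + p₁) * spt₂ μ e := by
    intro e he
    have := hS (eswap e) ((mem_pts_comp_σ₁₂_iff c J μ e).mp he)
    rw [spt₁_eswap, spt₂_eswap] at this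
    rw [add_comm p₂ p₁]; omega
  have key := forall_pts_colon_of_forall_pts φ (chartTwo_h₁ φ h₂) (chartTwo_h₀ φ h₀) (chartTwo_h₂ φ h₁)
    (chartTwo_hgen hgen) hdim (chartTwo_hgen' hgen') hdim' hw₀' hp₂ hp₁ hS'
  rw [colon_comp_σ₁₂] at key
  intro e' he'
  have := key (eswap e') ((mem_pts_comp_σ₁₂_iff c' _ μ (eswap e')).mpr (by simpa using he'))
  rw [spt₁_eswap, spt₂_eswap] at this
  omega

include h₂ h₀ h₁ hgen hdim hgen' hdim' in
/-- **`βs″ + L = αs + βs`** at the origin of the `u₂`-chart (`J ⊆ 𝔪^μ`, `δ > 1`): the vertex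
`v″` is `T(v) = (α, α + β − 1)`. [cite: CossartJannsenSaito2020, Lemma 12.2 (3)] [cite: CossartPiltant2008, Lemma 4.5 (2)] -/
theorem betaS_colon_two_add_eq (hJμ : J ≤ maximalIdeal R ^ μ) (hne : (pts c J μ).Nonempty)
    (hδ : μ.factorial < deltaS c J μ) :
    betaS c' J'' μ + μ.factorial = alphaS c J μ + betaS c J μ := by
  refine le_antisymm (betaS_colon_two_add_le φ h₂ h₀ h₁ hgen hdim hgen' hdim' hJμ hne hδ) ?_
  have hne'' := pts_colon_two_nonempty φ h₂ h₀ h₁ hgen hdim hgen' hdim' hJμ hne hδ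
  have hα'' := alphaS_colon_two_eq φ h₂ h₀ h₁ hgen hdim hgen' hdim' hJμ hne hδ
  obtain ⟨ev, hev, hev1, hev2⟩ := exists_pts_v hne''
  -- the steep line `N x₁ + x₂ ≥ (N+1) αs + βs − L` with `N = βs + 1`
  set N := betaS c J μ + 1 with hN
  by_cases hw : (N + 1) * alphaS c J μ + betaS c J μ ≤ μ.factorial
  · -- trivial case
    have : alphaS c J μ ≤ (N + 1) * alphaS c J μ := Nat.le_mul_of_pos_left _ (by omega)
    omega
  push Not at hw
  have hS : ∀ e ∈ pts c J μ, ((N + 1) * alphaS c J μ + betaS c J μ - μ.factorial) + μ.factorial * 1 ≤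
      (N + 1) * spt₁ μ e + 1 * spt₂ μ e := by
    intro e he
    have := forall_pts_steep (c := c) (J := J) (μ := μ) (N := N + 1) (by omega) e he
    omega
  have key := forall_pts_colon_two_of_forall_pts φ h₂ h₀ h₁ hgen hdim hgen' hdim'
    (w₀' := (N + 1) * alphaS c J μ + betaS c J μ - μ.factorial) (p₁ := N) (p₂ := 1)
    (by omega) (by omega) Nat.one_pos hS ev hev
  rw [hev1, hev2, hα'', one_mul] at key
  have hsplit : (N + 1) * alphaS c J μ = N * alphaS c J μ + alphaS c J μ := by ring
  rw [hsplit] at key hw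
  omega

include h₂ h₀ h₁ hgen hdim hgen' hdim' in
/-- **`v″`-preparedness at `(0:1)`** (CJS Lemma 12.2 (4)-type statement for the `u₂`-chart): if
`(y, u₁, u₂)` is `v`-prepared, `J ⊆ 𝔪^μ`, `δ > 1`, and the residue map is surjective, then
`(y″, u₁″, u₂)` is `v″`-prepared for the weak transform. [cite: CossartJannsenSaito2020, Lemma 12.2, Lemma 8.3] [cite: CossartPiltant2008, Lemma 4.5 (2)] -/
theorem vPrepared_colon_two [IsLocalHom φ] (hψ : Function.Surjective (ResidueField.map φ))
    (hJμ : J ≤ maximalIdeal R ^ μ) (hne : (pts c J μ).Nonempty) (hδ : μ.factorial < deltaS c J μ)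
    (hvprep : VPrepared c J μ) : VPrepared c' J'' μ := by
  have hne'' := pts_colon_two_nonempty φ h₂ h₀ h₁ hgen hdim hgen' hdim' hJμ hne hδ
  have hα'' := alphaS_colon_two_eq φ h₂ h₀ h₁ hgen hdim hgen' hdim' hJμ hne hδ
  have hβ'' := betaS_colon_two_add_eq φ h₂ h₀ h₁ hgen hdim hgen' hdim' hJμ hne hδ
  intro v₁ v₂ lam'' hv1 hv2 hsol
  -- integrality of `v = (v₁, v₂ + 1 − v₁)`
  have hv12 : v₁ ≤ v₂ + 1 := by
    by_contra hlt
    push Not at hlt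
    have : μ.factorial * (v₂ + 1) < μ.factorial * v₁ :=
      Nat.mul_lt_mul_of_pos_left hlt (Nat.factorial_pos μ)
    rw [Nat.mul_add, mul_one, ← hv1, ← hv2, hα''] at this
    omega
  set vR₂ := v₂ + 1 - v₁ with hvR₂
  have hαv : alphaS c J μ = μ.factorial * v₁ := by rw [← hα'', hv1]
  have hβv : betaS c J μ = μ.factorial * vR₂ := by
    have : μ.factorial * vR₂ + μ.factorial * v₁ = μ.factorial * (v₂ + 1) := by
      rw [← Nat.mul_add]; congr 1; omega
    rw [Nat.mul_add, mul_one, ← hv2] at this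
    omega
  -- a very steep line at `x″`: `N⋆ x₁ + x₂` with `N⋆ = βs″ + βs + 1`
  set Ns := betaS c' J'' μ + betaS c J μ + 1 with hNs
  have hNs1 : betaS c' J'' μ + 1 ≤ Ns := by omega
  have hsolS : IsSolvableAt c' J'' (levelWeight μ (Ns * alphaS c' J'' μ + betaS c' J'' μ) Ns 1)
      ((Ns * alphaS c' J'' μ + betaS c' J'' μ) * μ) μ (vexp v₁ v₂) lam'' := by
    have hpos : 0 < vLevel c' J'' μ := by
      rw [vLevel, steepN]
      have := deltaS_le_alphaS_add_betaS hne''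
      -- `αs″ + βs″ > 0`: else `δs″ = 0`, but `δs″ ≥ ...`; use `βs″ + L = αs + βs ≥ δs > L`
      have h2 : 0 < alphaS c' J'' μ + betaS c' J'' μ := by
        have := deltaS_le_alphaS_add_betaS hne; omega
      nlinarith
    have hposS : 0 < Ns * alphaS c' J'' μ + betaS c' J'' μ := by
      have h2 : 0 < alphaS c' J'' μ + betaS c' J'' μ := by
        have := deltaS_le_alphaS_add_betaS hne; omega
      have : alphaS c' J'' μ ≤ Ns * alphaS c' J'' μ := Nat.le_mul_of_pos_left _ (by omega)
      omega
    refine (isSolvableAt_iff_of_same_vertex c' hgen' hdim' (J := J'') (μ := μ)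
      (w₀ := vLevel c' J'' μ) (p₁ := steepN c' J'' μ) (p₂ := 1)
      (q₀ := Ns * alphaS c' J'' μ + betaS c' J'' μ) (q₁ := Ns) (q₂ := 1) (v₁ := v₁) (v₂ := v₂)
      hpos (by rw [steepN]; omega) Nat.one_pos hposS (by omega) Nat.one_pos
      (by rw [vLevel, ← hv1, ← hv2]; ring) (by rw [← hv1, ← hv2]; ring)
      forall_pts_vWeight (forall_pts_steep hNs1)
      (fun e he h => by
        obtain ⟨ha, hb⟩ := eq_v_of_vLine he h
        exact ⟨by rw [ha, hv1], by rw [hb, hv2]⟩)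
      (fun e he h => by
        obtain ⟨ha, hb⟩ := eq_v_of_steep hNs1 he h
        exact ⟨by rw [ha, hv1], by rw [hb, hv2]⟩) lam'').mp hsol
  -- swap at `x″` and pull back through the chart
  obtain ⟨lamR, hlamR⟩ : ∃ a : R, residue R' (φ a) = lam'' := by
    obtain ⟨b, hb⟩ := hψ lam''
    obtain ⟨a, rfl⟩ := residue_surjective (R := R) b
    exact ⟨a, by rw [← hb, ResidueField.map_residue]⟩
  set W' : Fin 3 → ℕ := (levelWeight μ (Ns * alphaS c' J'' μ + betaS c' J'' μ) Ns 1) ∘ σ₁₂ with hW'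
  have hW'pos : ∀ i, 0 < W' i := by
    rw [hW', forall_pos_comp_σ₁₂_iff]
    have hposS : 0 < Ns * alphaS c' J'' μ + betaS c' J'' μ := by
      have h2 : 0 < alphaS c' J'' μ + betaS c' J'' μ := by
        have := deltaS_le_alphaS_add_betaS hne; omega
      have : alphaS c' J'' μ ≤ Ns * alphaS c' J'' μ := Nat.le_mul_of_pos_left _ (by omega)
      omega
    exact levelWeight_pos hposS (by omega) Nat.one_pos
  have hwS : ∀ i, 0 < levelWeight μ (Ns * alphaS c' J'' μ + betaS c' J'' μ) Ns 1 i :=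
    (forall_pos_comp_σ₁₂_iff _).mp hW'pos
  have hsolS' : IsSolvableAt (c' ∘ σ₁₂) ((J.map φ).colon {φ ((c ∘ σ₁₂) 1) ^ μ}) W' (μ * W' 0) μ
      (vexp (vR₂ + v₁ - 1) v₁) (residue R' (φ lamR)) := by
    rw [colon_comp_σ₁₂]
    have hvexp : vexp (vR₂ + v₁ - 1) v₁ = eswap (vexp v₁ v₂) := by
      ext i; fin_cases i
      · simp
      · simp; omega
      · simp
    rw [hvexp, hW', isSolvableAt_comp_σ₁₂_iff c' hgen' hdim' _ hwS, hlamR]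
    have : μ * (levelWeight μ (Ns * alphaS c' J'' μ + betaS c' J'' μ) Ns 1 ∘ σ₁₂) 0 =
        (Ns * alphaS c' J'' μ + betaS c' J'' μ) * μ := by
      rw [Function.comp_apply, σ₁₂_zero, levelWeight_zero, mul_comm]
    rw [this]; exact hsolS
  -- pull back through the chart (for the swapped systems)
  have hv : 1 ≤ vR₂ + v₁ := by omega
  have hvW : Finsupp.weight (pullbackWeight W') (vexp vR₂ v₁) = pullbackWeight W' 0 := by
    rw [weight_vexp]
    simp only [hW', pullbackWeight, Function.comp_apply, σ₁₂_zero, σ₁₂_one, σ₁₂_two,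
      levelWeight_zero, levelWeight_one, levelWeight_two, Matrix.cons_val_zero, Matrix.cons_val_one,
      Matrix.cons_val_two, Matrix.tail_cons, Matrix.head_cons, hα'']
    have : μ.factorial * vR₂ + μ.factorial * v₁ = μ.factorial * v₂ + μ.factorial := by
      rw [← Nat.mul_add, ← Nat.mul_succ]; congr 1; omega
    nlinarith [this]
  have hsolR := isSolvableAt_of_chart φ (chartTwo_h₁ φ h₂) (chartTwo_h₀ φ h₀) (chartTwo_h₂ φ h₁) W'
    (chartTwo_hgen hgen) hdim (chartTwo_hgen' hgen') hdim' hW'pos hψ hJμ hv hvW hsolS'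
  -- unswap on `R`: the pulled-back weight is the steep line `(Ns+1) x₁ + x₂` through `v`
  set X := Ns * alphaS c' J'' μ + betaS c' J'' μ + μ.factorial with hX
  have hpb : pullbackWeight W' = (levelWeight μ X (Ns + 1) 1) ∘ σ₁₂ := by
    funext i
    fin_cases i
    · simp [hW', pullbackWeight, levelWeight_zero, levelWeight_one, hX]
    · simp [hW', pullbackWeight, levelWeight_one, levelWeight_two]
    · simp [hW', pullbackWeight, levelWeight_one, levelWeight_two]; ring
  have hXpos : 0 < X := by rw [hX]; have := Nat.factorial_pos μ; omega
  have hwX : ∀ i, 0 < levelWeight μ X (Ns + 1) 1 i := levelWeight_pos hXpos (by omega) Nat.one_pos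
  rw [hpb] at hsolR
  have hvexp2 : vexp vR₂ v₁ = eswap (vexp v₁ vR₂) := by
    ext i; fin_cases i <;> simp
  rw [hvexp2, isSolvableAt_comp_σ₁₂_iff c hgen hdim J hwX] at hsolR
  have hlev : μ * (levelWeight μ X (Ns + 1) 1 ∘ σ₁₂) 0 = X * μ := by
    rw [Function.comp_apply, σ₁₂_zero, levelWeight_zero, mul_comm]
  rw [hlev] at hsolR
  -- the line `(Ns+1) x₁ + x₂ = X = (Ns+1) αs + βs` passes through `v` only
  have hXeq : X = (Ns + 1) * alphaS c J μ + betaS c J μ := by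
    rw [hX, hα'']
    have := hβ''
    have hsplit : (Ns + 1) * alphaS c J μ = Ns * alphaS c J μ + alphaS c J μ := by ring
    omega
  have hNs2 : betaS c J μ + 1 ≤ Ns + 1 := by omega
  refine hvprep v₁ vR₂ (residue R lamR) hαv hβv ?_
  have hposV : 0 < vLevel c J μ := by
    rw [vLevel, steepN]
    have h2 : 0 < alphaS c J μ + betaS c J μ := by
      have := deltaS_le_alphaS_add_betaS hne; omega
    nlinarith
  refine (isSolvableAt_iff_of_same_vertex c hgen hdim (J := J) (μ := μ)
    (w₀ := vLevel c J μ) (p₁ := steepN c J μ) (p₂ := 1)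
    (q₀ := X) (q₁ := Ns + 1) (q₂ := 1) (v₁ := v₁) (v₂ := vR₂)
    hposV (by rw [steepN]; omega) Nat.one_pos hXpos (by omega) Nat.one_pos
    (by rw [vLevel, ← hαv, ← hβv]; ring) (by rw [hXeq, ← hαv, ← hβv]; ring)
    forall_pts_vWeight (by rw [hXeq]; exact forall_pts_steep hNs2)
    (fun e he h => by
      obtain ⟨ha, hb⟩ := eq_v_of_vLine he h
      exact ⟨by rw [ha, hαv], by rw [hb, hβv]⟩)
    (fun e he h => by
      rw [hXeq] at h
      obtain ⟨ha, hb⟩ := eq_v_of_steep hNs2 he h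
      exact ⟨by rw [ha, hαv], by rw [hb, hβv]⟩) (residue R lamR)).mpr hsolR

end ChartTwo

end Literature.AlgebraicGeometry.Resolution
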